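import Literature.MathematicalPhysics.QuantumFieldTheory.Balaban1983to89.B5CombesThomasTorus

/-!
# `Balaban1983to89.B4Cor23ZeroTorusSolve` — T. Bałaban, *Regularity and decay of lattice Green's functions*, Commun. Math. Phys.
# **89** (1983) 571–597 [Balaban1983RegularityDecay], Corollary 2.3 (2.30) at `A = 0` ON THE TORUS, file 1 of 2: the exponentially
# conjugated quadratic form of `Marg = −Δ^η + (L^kε)²m² + a_kQ^*_kQ_k` (`η = L^{−k}`, scalar block averaging `Q_k`), its coercivity on
# the Dirichlet form, and the two WEIGHTED SOLVES `Σ_μ‖∂_μ(e^{δρ}G_k g)‖² + ‖e^{δρ}G_k g‖² ≤ c‖e^{δρ}g‖²` for the sources `g` and `∂^{η⊤}_νg`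

statement-level skeleton of published theorems with citation tags; proofs where landed; nothing here is a claim about the Yang–Mills mass gap

PDF held: `paper:balaban1983-cmp89-regularity-decay` (journal page = PDF page + 570), p. 580 [PDF 10] (2.26)–(2.30), p. 581 [PDF 11] (end
of Cor. 2.3), p. 573 [PDF 3] (1.8), p. 572 [PDF 2] (the torus), materialised `p0010.txt`, `p0011.txt`, `p0003.txt` and read by this seat;
the display (2.30) is quoted in full in the tree (`B4.Cor23Printed`, `B4Cor23Zero`).

CITATION HEADER (lean-in-tree rule).  Cell `lit-balaban` (HOME `run/shared/lean/pub/lit-balaban/`), Phase-2 proof seat **p14** gen 10 (unit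
`lit-balaban-p14`); SKELETON row **B4.Cor2.3** (owner r01): a TORUS INSTANCE at `A = 0` (`Ω = Ω₀ = T_η`) of (2.30), all four pairings —
the sequel of `B1Cor23ZeroFieldTorus` (p14 gen 9: the FIRST pairing only, by Schur's test over sup-norm bounds; the fourth pairing
`⟨f, ∂G∂*f′⟩` is NOT reachable that way, `∂_μG_k∂*_ν` being unbounded on `ℓ^∞` uniformly in `η`).  The mechanism is the one b04's
`B4Cor23Zero` runs for NEUMANN REGIONS of `ℤ^{d+1}` (one-step Combes–Thomas in quadratic-form language: conjugate by `e^{δρ}`, absorb the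
`O(δ²)` error in the coercivity (1.8), Cauchy–Schwarz), here run on Bałaban's concrete scalar TORUS tower with the conjugation lemmas of
p38's `B5CombesThomasTorus` (which treats B5's `G₀ = (Δ + aQ*Q)⁻¹` with the VECTOR averaging `Q_μ`; this file needs the SCALAR `Q_k`).  USED
BY NAME, never restated: `B5CombesThomasTorus.{LipX, wt, pmul, conjLap_ge, abs_deriv_pmul_le, nsq, dirE, dot_le_sqrt_nsq,
sum_abs_mul_abs_le_sqrt_nsq, sqrt_parts_le, sq_le_of_quad, pmul_inv_pmul, pmul_pmul_dot, eps_div_spacing}`, `B4Ineq115Torus.{Marg,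
Marg_coercive, form_Marg, avg_dot_eq, avg_sq_le, Marg_mul_Grs, deriv_eps_div_spacing}`, `B5Display136Torus.Grs`, `B5Ineq137Torus.{distX, T,
T_blk_le, T_triangle}`, `B1.{aSeq, ainf_lt_aSeq, aSeq_le}`.

WHAT IS PRINTED (verbatim).  p. 580 [PDF 10]: *"hence ‖∂^η_μG_k^{1/2}(□,0)‖_{2,2} = ‖G_k^{1/2}(□,0)∂^{η*}_μ‖_{2,2} ≤ 1, and this together
with (2.28) imply the bounds (2.25). Thus the Lemma 2.1 is proved.  Remark. Let us notice that this lemma alone implies a weaker version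
of Proposition I.2.1 with L²-norms. More exactly we have  Corollary 2.3. If Ω and A are as in Proposition I.2.1, then there exist positive
constants c₀, δ₀ such that for arbitrary scalar field configurations f, f′ defined on Ω, we have |⟨f, G_k(Ω,A)f′⟩|, |⟨f, D^η_{A,μ}G_k(Ω,A)f′⟩|,
|⟨f, G_k(Ω,A)D^{η*}_{A,ν}f′⟩|, |⟨f, D^η_{A,μ}G_k(Ω,A)D^{η*}_{A,ν}f′⟩| ≤ c₀e^{−δ₀dist(supp f, supp f′)}‖f‖₂‖f′‖₂. (2.30)"*; p. 581: *"Of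
course it is enough to prove it for f, f′ with supports in unit cubes, and the proof proceeds as before using only the L²-bounds of
Lemma 2.1."*; p. 573 [PDF 3]: *"−Δ^{η,N}_{A,Ω} + aP_k(A) ≥ γ₀I. (1.8) The constant γ₀ is independent of the lattice spacing η, as well as of Ω
and of A. This bound justifies the definition (1.6) and explains exponential decay properties."*; p. 572: *"Another common case is to
consider operators on subsets of a torus T_η which we identify with a rectangular parallelepiped in ηZ^d with periodic conditions."*

WHAT THIS FILE PROVES (kernel-checked, zero `sorry`, theorems only).  Throughout: Bałaban's torus `T_η = Site P 0` of the `Setup`/`Params`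
family at level `k ≤ m + K` (`η = L^{−k}`, `B5CombesThomasTorus.eps_div_spacing`), the rescaled operator `Marg P a m² k = −Δ^η + (L^kε)²m² +
a_kQ^*_kQ_k` of [B1] (2.22) / [B4] (1.6) (`U = 1`), `G_k^{resc} = Grs P a m² k = Marg⁻¹`, a 1-Lipschitz (for `distX`) exponent `ρ`, the
weight `w = e^{δρ}` (`wt`), unweighted sums `nsq`, `dirE` (the common factor `η^d` of `L²(T_η)` is restored by consumers).
* §1 `conjQk_fibre`, `dot_QksQk`, **`conjQk_ge`**: `(wu)·Q^*_kQ_k(w⁻¹u) ≥ u·Q^*_kQ_ku − 4δ²Σu²` (`2δ ≤ 1`; two points of one `k`-block are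
  `≤ 2` apart in `η`-units: `distX_le_two_of_proj_eq`).
* §2 **`conjMarg_ge`**: `(wu)·Marg(w⁻¹u) ≥ u·Marg u − (2d + 4a_k)δ²Σu²` (`conjLap_ge` + §1) — the conjugation error of `e^{δρ}(Marg)e^{−δρ}`.
* §3 `dirE_eq`, **`Marg_coercive_dirE`**: `½min{1, a(1 − L⁻²)}·(Σ_μ‖∂^η_μu‖² + ‖u‖²) ≤ u·Marg u` for `k ≥ 1`, `m² ≥ 0` ((1.8) on the torus in
  the form the solves need: `B4Ineq115Torus.Marg_coercive` (`min{8, a_k}`) + `a(1 − L⁻²) < a_k` + the Dirichlet part of `form_Marg`).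
* §4 **`solve_bound`** / **`solveT_bound`**: for `0 ≤ δ`, `4δ ≤ 1`, `(2d + 4a)δ² ≤ ¼min{1, a(1 − L⁻²)}`, every source `g`, with
  `v = G_k^{resc}g` (resp. `v = G_k^{resc}∂^{η⊤}_νg`) and `u = e^{δρ}v`:  `Σ_μ‖∂^η_μu‖² + ‖u‖² ≤ (4/γ′)²‖e^{δρ}g‖²` (resp. `(8/γ′)²`),
  `γ′ = min{1, a(1 − L⁻²)}` — the `L²` content of (2.28)–(2.29) surviving the conjugation.
HONEST SCOPE / DIVERGENCE.  (i) `A = 0`, `U ≡ 1`, one component, the WHOLE torus (no `Ω ⊊ T_η`, no `δG_k(Ω,Ω₀,A)` clause); (ii) the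
print's proof of Cor. 2.3 is the random-walk expansion of §2 with the `L²` bounds of Lemma 2.1 — this file runs instead the one-step
Combes–Thomas conjugation (the route b04 certified for Neumann regions in `B4Cor23Zero`, and the «simplest proof» B5 p. 36 names), a
disclosed DIVERGENCE of method serving the printed statement (2.30), assembled in file 2 `B4Cor23ZeroTorus`; (iii) constants explicit but
crude (`γ′/2` in place of the print's `γ₀`; `8` for `π²` as in `B4Ineq115Torus`); (iv) nothing here is summit progress.
-/

namespace Literature.MathematicalPhysics.QuantumFieldTheory.Balaban1983to89

open Matrix Finset

noncomputable section

namespace B4Cor23ZeroTorusSolve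

open B1RG242Torus B5Ineq137Torus B5CombesThomasTorus B4Ineq115Torus B5Display136Torus

variable {P : Params} {k : ℕ}

/-! ## §0 Elementary bounds for the conjugation ratio -/

/-- `t + t⁻¹ − 2 ≤ 2σ²` for `t = e^σ`, `|σ| ≤ 1` (from `|e^x − 1 − x| ≤ x²`). [folklore] -/
private theorem ratio_le {σ : ℝ} (h : |σ| ≤ 1) : Real.exp σ + (Real.exp σ)⁻¹ - 2 ≤ 2 * σ ^ 2 := by
  have h1 := Real.abs_exp_sub_one_sub_id_le h
  have h2 := Real.abs_exp_sub_one_sub_id_le (show |(-σ)| ≤ 1 by rwa [abs_neg])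
  have e1 := (abs_le.mp h1).2
  have e2 := (abs_le.mp h2).2
  rw [← Real.exp_neg]
  nlinarith

/-- `0 ≤ t + t⁻¹ − 2` for `t = e^σ`. [folklore] -/
private theorem ratio_nonneg (σ : ℝ) : 0 ≤ Real.exp σ + (Real.exp σ)⁻¹ - 2 := by
  rw [← Real.exp_neg]
  have hp := Real.exp_pos σ
  have hprod : Real.exp σ * Real.exp (-σ) = 1 := by rw [← Real.exp_add, add_neg_cancel, Real.exp_zero]
  nlinarith [sq_nonneg (Real.exp σ - Real.exp (-σ)), Real.exp_pos (-σ)]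

/-- the termwise inequality behind the symmetrization of the conjugated averaging form. [folklore] -/
private theorem term_ineq {q q' t c u u' : ℝ} (hq : 0 ≤ q) (hq' : 0 ≤ q') (ht0 : 0 ≤ t + t⁻¹ - 2)
    (ht : t + t⁻¹ - 2 ≤ c) :
    2 * (q * q' * (u * u')) - c * (q * q' * (|u| * |u'|))
      ≤ q * q' * (t * (u * u')) + q * q' * (t⁻¹ * (u * u')) := by
  have hqq : 0 ≤ q * q' := mul_nonneg hq hq'
  have h1 : (t + t⁻¹ - 2) * (u * u') ≥ -(c * (|u| * |u'|)) := by
    have hab : |(t + t⁻¹ - 2) * (u * u')| ≤ c * (|u| * |u'|) := by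
      rw [abs_mul, abs_of_nonneg ht0, abs_mul]
      exact mul_le_mul_of_nonneg_right ht (mul_nonneg (abs_nonneg _) (abs_nonneg _))
    have := neg_abs_le ((t + t⁻¹ - 2) * (u * u'))
    linarith
  nlinarith

/-! ## §1 The conjugated SCALAR averaging form `Q^*_kQ_k` -/

section Averaging

/-- The entries of `Q_k` (B1 (2.11), `U = 1`): `Q_k(y, x) = w_k·[x ∈ B^k(y)]`, `w_k = L^{−d·lvl k}`. [cite: Balaban1982Higgs1, (2.11) p.609] -/
theorem Qk_apply (k : ℕ) (y : Site P k) (x : Site P 0) :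
    Qk P k y x = if Site.proj k (lvl P k) x = y then wj P k else 0 := rfl

/-- the entries of `Q_k` are non-negative. [folklore] -/
private theorem Qk_nonneg (k : ℕ) (y : Site P k) (x : Site P 0) : 0 ≤ Qk P k y x := by
  rw [Qk_apply]
  split_ifs
  · exact (wj_pos P k).le
  · exact le_rfl

/-- a point of the support of `Q_k(y, ·)` lies in the block `B^k(y)` (Bałaban's levels `k ≤ m + K`). [folklore] -/
private theorem proj_eq_of_Qk_ne_zero (hk : k ≤ P.m + P.K) {y : Site P k} {x : Site P 0} (h : Qk P k y x ≠ 0) :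
    Site.proj k k x = y := by
  rw [Qk_apply, lvl_of_le P hk] at h
  by_contra hne
  exact h (if_neg hne)

/-- **Two points of one `k`-block are at most `2` apart in `η`-units** (each is within `L^k − 1` fine steps of the block corner).
[cite: Balaban1983RegularityDecay, (1.4) p.572] -/
theorem distX_le_two_of_proj_eq (hk : k ≤ P.m + P.K) {x x' : Site P 0} (h : Site.proj k k x = Site.proj k k x') :
    distX P k x x' ≤ 2 := by
  have hL : (0 : ℝ) < (P.L : ℝ) ^ k := pow_pos P.cast_L_pos k
  have h1 : T P 0 x (fine P k (blk P k x')) ≤ (P.L : ℝ) ^ k - 1 := by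
    have := T_blk_le P hk x
    have hb : blk P k x = blk P k x' := h
    rwa [hb] at this
  have h2 : T P 0 (fine P k (blk P k x')) x' ≤ (P.L : ℝ) ^ k - 1 := by
    rw [T_symm]; exact T_blk_le P hk x'
  have h3 := T_triangle P 0 x (fine P k (blk P k x')) x'
  unfold distX
  rw [inv_mul_le_iff₀ hL]
  linarith

/-- For a Lipschitz `ρ`: `|ρ x − ρ x′| ≤ 2` on the support of `Q_k(y, ·)`. [cite: Balaban1983RegularityDecay, (1.4) p.572] -/
theorem abs_sub_le_two_of_Qk {ρ : Site P 0 → ℝ} (hρ : LipX P k ρ) (hk : k ≤ P.m + P.K) {y : Site P k}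
    {x x' : Site P 0} (h : Qk P k y x ≠ 0) (h' : Qk P k y x' ≠ 0) : |ρ x - ρ x'| ≤ 2 :=
  (hρ x x').trans (distX_le_two_of_proj_eq hk ((proj_eq_of_Qk_ne_zero hk h).trans (proj_eq_of_Qk_ne_zero hk h').symm))

/-- **Conjugated scalar averaging, one block**: with `w = e^{δρ}`, `ρ` Lipschitz and `2δ ≤ 1`,
`(Q_k(wu))(y)·(Q_k(w⁻¹u))(y) ≥ (Q_ku)(y)² − 4δ²(Q_k|u|)(y)²`. [cite: Balaban1983RegularityDecay, (1.4)–(1.5) p.572, (1.8) p.573] -/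
theorem conjQk_fibre {ρ : Site P 0 → ℝ} (hρ : LipX P k ρ) (hk : k ≤ P.m + P.K) {δ : ℝ} (hδ0 : 0 ≤ δ)
    (hδ2 : 2 * δ ≤ 1) (y : Site P k) (u : Site P 0 → ℝ) :
    ((Qk P k *ᵥ u) y) ^ 2 - 4 * δ ^ 2 * ((Qk P k *ᵥ fun x => |u x|) y) ^ 2
      ≤ (Qk P k *ᵥ pmul (wt P δ ρ) u) y * (Qk P k *ᵥ pmul (fun z => (wt P δ ρ z)⁻¹) u) y := by
  set q : Site P 0 → ℝ := fun x => Qk P k y x with hqdef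
  have hq : ∀ x, 0 ≤ q x := fun x => Qk_nonneg k y x
  set w := wt P δ ρ with hwdef
  have hw : ∀ z, w z ≠ 0 := wt_ne_zero δ ρ
  have hAB : (Qk P k *ᵥ pmul w u) y * (Qk P k *ᵥ pmul (fun z => (w z)⁻¹) u) y
      = ∑ x, ∑ x', q x * q x' * ((w x / w x') * (u x * u x')) := by
    simp only [Matrix.mulVec, dotProduct, pmul_apply, sum_mul_sum]
    refine sum_congr rfl fun x _ => sum_congr rfl fun x' _ => ?_
    rw [div_eq_mul_inv]; ring
  have hBA : (Qk P k *ᵥ pmul w u) y * (Qk P k *ᵥ pmul (fun z => (w z)⁻¹) u) y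
      = ∑ x, ∑ x', q x * q x' * ((w x / w x')⁻¹ * (u x * u x')) := by
    rw [mul_comm]
    simp only [Matrix.mulVec, dotProduct, pmul_apply, sum_mul_sum]
    refine sum_congr rfl fun x _ => sum_congr rfl fun x' _ => ?_
    rw [inv_div, div_eq_mul_inv]; ring
  have hsq : ((Qk P k *ᵥ u) y) ^ 2 = ∑ x, ∑ x', q x * q x' * (u x * u x') := by
    simp only [Matrix.mulVec, dotProduct, sq, sum_mul_sum]
    refine sum_congr rfl fun x _ => sum_congr rfl fun x' _ => ?_
    ring
  have habs : ((Qk P k *ᵥ fun x => |u x|) y) ^ 2 = ∑ x, ∑ x', q x * q x' * (|u x| * |u x'|) := by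
    simp only [Matrix.mulVec, dotProduct, sq, sum_mul_sum]
    refine sum_congr rfl fun x _ => sum_congr rfl fun x' _ => ?_
    ring
  have hterm : ∀ x x', 2 * (q x * q x' * (u x * u x')) - 8 * δ ^ 2 * (q x * q x' * (|u x| * |u x'|))
      ≤ q x * q x' * ((w x / w x') * (u x * u x')) + q x * q x' * ((w x / w x')⁻¹ * (u x * u x')) := by
    intro x x'
    by_cases hx : Qk P k y x = 0
    · have : q x = 0 := hx
      rw [this]; simp
    by_cases hx' : Qk P k y x' = 0
    · have : q x' = 0 := hx'
      rw [this]; simp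
    have hρ2 := abs_sub_le_two_of_Qk hρ hk hx hx'
    set σ := δ * (ρ x - ρ x') with hσ
    have ht : w x / w x' = Real.exp σ := wt_div δ ρ x' x
    have hσδ : |σ| ≤ 2 * δ := by
      rw [hσ, abs_mul, abs_of_nonneg hδ0]
      calc δ * |ρ x - ρ x'| ≤ δ * 2 := mul_le_mul_of_nonneg_left hρ2 hδ0
        _ = 2 * δ := by ring
    have hσ1 : |σ| ≤ 1 := hσδ.trans hδ2
    have hb := ratio_le hσ1
    have hσsq : σ ^ 2 ≤ (2 * δ) ^ 2 := by
      rw [← sq_abs σ]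
      exact pow_le_pow_left₀ (abs_nonneg σ) hσδ 2
    rw [ht]
    exact term_ineq (hq x) (hq x') (ratio_nonneg σ) (hb.trans (by nlinarith))
  have hsum := sum_le_sum fun x (_ : x ∈ (univ : Finset (Site P 0))) =>
    sum_le_sum fun x' (_ : x' ∈ (univ : Finset (Site P 0))) => hterm x x'
  simp only [sum_sub_distrib, ← mul_sum, sum_add_distrib] at hsum
  rw [← hsq, ← habs, ← hAB, ← hBA] at hsum
  linarith

/-- The unweighted bilinear form of `Q^*_kQ_k`: `φ·Q^*_k(Q_kψ) = w_k⁻¹·(Q_kφ)·(Q_kψ)` (`Q^*_k = w_k⁻¹Q_kᵀ`).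
[cite: Balaban1982Higgs1, (1.5) p.604, (2.20) p.610] -/
theorem dot_QksQk (k : ℕ) (φ ψ : Site P 0 → ℝ) :
    φ ⬝ᵥ ((Qks P k * Qk P k) *ᵥ ψ) = (wj P k)⁻¹ * ((Qk P k *ᵥ φ) ⬝ᵥ (Qk P k *ᵥ ψ)) := by
  have hw : wj P k ≠ 0 := (wj_pos P k).ne'
  rw [← Matrix.mulVec_mulVec, Qk_eq, show Qks P k = extMat P 0 k (lvl P k) from rfl, avg_dot_eq, ← mul_assoc,
    inv_mul_cancel₀ hw, one_mul]

/-- Jensen for `Q_k`: `w_k⁻¹·Σ_y (Q_k|u|)(y)² ≤ Σ_x u(x)²`. [cite: Balaban1982Higgs1, (2.11) p.609] -/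
theorem inv_wj_mul_sum_sq_Qk_abs_le (k : ℕ) (u : Site P 0 → ℝ) :
    (wj P k)⁻¹ * ((Qk P k *ᵥ fun x => |u x|) ⬝ᵥ (Qk P k *ᵥ fun x => |u x|)) ≤ nsq P u := by
  have hw := wj_pos P k
  have hJ : ((Qk P k *ᵥ fun x => |u x|) ⬝ᵥ (Qk P k *ᵥ fun x => |u x|)) ≤ wj P k * ((fun x => |u x|) ⬝ᵥ fun x => |u x|) :=
    avg_sq_le P (sitesPerDir_zero_eq P k) (fun x => |u x|)
  have habs : ((fun x => |u x|) ⬝ᵥ fun x => |u x|) = nsq P u := by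
    rw [nsq_eq_dot]; simp only [dotProduct, ← sq, sq_abs]
  rw [habs] at hJ
  calc (wj P k)⁻¹ * ((Qk P k *ᵥ fun x => |u x|) ⬝ᵥ (Qk P k *ᵥ fun x => |u x|))
      ≤ (wj P k)⁻¹ * (wj P k * nsq P u) := mul_le_mul_of_nonneg_left hJ (inv_nonneg.mpr hw.le)
    _ = nsq P u := by rw [← mul_assoc, inv_mul_cancel₀ hw.ne', one_mul]

/-- **Conjugated form of the scalar `Q^*_kQ_k`**: `(wu)·Q^*_kQ_k(w⁻¹u) ≥ u·Q^*_kQ_ku − 4δ²Σu²` (`2δ ≤ 1`, `k ≤ m + K`).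
[cite: Balaban1983RegularityDecay, (1.5) p.572, (1.8) p.573] -/
theorem conjQk_ge {ρ : Site P 0 → ℝ} (hρ : LipX P k ρ) (hk : k ≤ P.m + P.K) {δ : ℝ} (hδ0 : 0 ≤ δ)
    (hδ2 : 2 * δ ≤ 1) (u : Site P 0 → ℝ) :
    u ⬝ᵥ ((Qks P k * Qk P k) *ᵥ u) - 4 * δ ^ 2 * nsq P u
      ≤ pmul (wt P δ ρ) u ⬝ᵥ ((Qks P k * Qk P k) *ᵥ pmul (fun z => (wt P δ ρ z)⁻¹) u) := by
  rw [dot_QksQk, dot_QksQk]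
  set c := (wj P k)⁻¹ with hc
  have hc0 : 0 ≤ c := inv_nonneg.mpr (wj_pos P k).le
  have hfib := fun y => conjQk_fibre hρ hk hδ0 hδ2 y u
  have hS := inv_wj_mul_sum_sq_Qk_abs_le (P := P) k u
  rw [← hc] at hS
  have h1 : c * ((Qk P k *ᵥ u) ⬝ᵥ (Qk P k *ᵥ u)) - 4 * δ ^ 2 * (c * ∑ y, ((Qk P k *ᵥ fun x => |u x|) y) ^ 2)
      ≤ c * ((Qk P k *ᵥ pmul (wt P δ ρ) u) ⬝ᵥ (Qk P k *ᵥ pmul (fun z => (wt P δ ρ z)⁻¹) u)) := by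
    have hsum := sum_le_sum fun y (_ : y ∈ (univ : Finset (Site P k))) => hfib y
    rw [sum_sub_distrib, ← mul_sum] at hsum
    have := mul_le_mul_of_nonneg_left hsum hc0
    rw [dot_self_eq_sum_sq]
    unfold dotProduct
    linarith
  have h2 : c * ∑ y, ((Qk P k *ᵥ fun x => |u x|) y) ^ 2 ≤ nsq P u := by
    rw [← dot_self_eq_sum_sq]; exact hS
  have hδ2' : 0 ≤ 4 * δ ^ 2 := by positivity
  have h3 := mul_le_mul_of_nonneg_left h2 hδ2'
  linarith

end Averaging

/-! ## §2 The conjugated form of `Marg = −Δ^η + (L^kε)²m² + a_kQ^*_kQ_k` -/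

section MargForm

/-- the bilinear form of `Marg` with the deriv scale written as `η = L^{−k}`. [cite: Balaban1982Higgs1, (2.22) p.610] -/
theorem biform_Marg (a msq : ℝ) (f g : Site P 0 → ℝ) :
    f ⬝ᵥ (Marg P a msq k *ᵥ g)
      = f ⬝ᵥ (hOp P 0 ((P.L : ℝ) ^ k)⁻¹ (P.spacing k ^ 2 * msq) *ᵥ g)
        + B1.aSeq a P.L k * (f ⬝ᵥ ((Qks P k * Qk P k) *ᵥ g)) := by
  rw [Marg, eps_div_spacing, Matrix.add_mulVec, Matrix.smul_mulVec, dotProduct_add, dotProduct_smul, smul_eq_mul]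

/-- **Conjugated form of `Marg`**: `(wu)·Marg(w⁻¹u) ≥ u·Marg u − (2d + 4a_k)δ²Σu²` for `ρ` Lipschitz, `0 ≤ δ`, `2δ ≤ 1`, `1 ≤ k ≤ m + K`
— the conjugation error of `e^{δρ}(−Δ^η + m_k² + a_kQ^*_kQ_k)e^{−δρ}` is `O(δ²)`, uniformly in `η`. [cite: Balaban1983RegularityDecay, (1.6),
(1.3) p.572, (1.8) p.573] -/
theorem conjMarg_ge {ρ : Site P 0 → ℝ} (hρ : LipX P k ρ) (hk : k ≤ P.m + P.K) (hk1 : 1 ≤ k) {a : ℝ} (ha : 0 < a)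
    {δ : ℝ} (hδ0 : 0 ≤ δ) (hδ2 : 2 * δ ≤ 1) (msq : ℝ) (u : Site P 0 → ℝ) :
    u ⬝ᵥ (Marg P a msq k *ᵥ u) - (2 * P.d + 4 * B1.aSeq a P.L k) * δ ^ 2 * nsq P u
      ≤ pmul (wt P δ ρ) u ⬝ᵥ (Marg P a msq k *ᵥ pmul (fun z => (wt P δ ρ z)⁻¹) u) := by
  rw [biform_Marg, biform_Marg]
  have hak : 0 ≤ B1.aSeq a P.L k := (B1.aSeq_pos ha (one_lt_cast_L P) hk1).le
  have h1 := conjLap_ge hρ hδ0 (by linarith) (P.spacing k ^ 2 * msq) u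
  have h2 := mul_le_mul_of_nonneg_left (conjQk_ge hρ hk hδ0 hδ2 u) hak
  unfold nsq at h2 ⊢
  nlinarith

end MargForm

/-! ## §3 Coercivity (1.8) on the torus, in the form controlling the Dirichlet form -/

section Coercive

/-- `Σ_μΣ_x(∂^η_μu)² = L^{2k}·Σ_μ‖∂¹_μu‖²` (`∂^η = L^k∂¹`, `η = L^{−k}`). [cite: Balaban1982Higgs1, (1.4) p.604, (2.22) p.610] -/
theorem dirE_eq (k : ℕ) (u : Site P 0 → ℝ) :
    dirE P k u = ((P.L : ℝ) ^ k) ^ 2 * ∑ μ, (deriv P 0 1 μ *ᵥ u) ⬝ᵥ (deriv P 0 1 μ *ᵥ u) := by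
  have hD : ∀ μ : Fin P.d, deriv P 0 ((P.L : ℝ) ^ k)⁻¹ μ = ((P.L : ℝ) ^ k) • deriv P 0 1 μ := by
    intro μ
    rw [← eps_div_spacing, deriv_eps_div_spacing]
  unfold dirE
  rw [Finset.mul_sum]
  refine sum_congr rfl fun μ _ => ?_
  rw [hD μ, Matrix.smul_mulVec, dot_self_eq_sum_sq, Finset.mul_sum]
  refine sum_congr rfl fun x _ => ?_
  rw [Pi.smul_apply, smul_eq_mul, mul_pow]

/-- `0 ≤ u·Q^*_kQ_ku` (`= w_k⁻¹‖Q_ku‖²`). [cite: Balaban1982Higgs1, (2.20) p.610] -/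
theorem dot_QksQk_self_nonneg (k : ℕ) (u : Site P 0 → ℝ) : 0 ≤ u ⬝ᵥ ((Qks P k * Qk P k) *ᵥ u) := by
  rw [dot_QksQk]
  exact mul_nonneg (inv_nonneg.mpr (wj_pos P k).le) (dot_self_nonneg _)

/-- **COERCIVITY OF `Marg` ON THE DIRICHLET FORM** ((1.8) on the torus at `A = 0`, in the shape the Combes–Thomas solves need): for `k ≥ 1`,
`m² ≥ 0`, `a > 0`:  `½min{1, a(1 − L⁻²)}·(Σ_μ‖∂^η_μu‖² + ‖u‖²) ≤ u·Marg u` — from `B4Ineq115Torus.Marg_coercive` (`min{8, a_k}‖u‖² ≤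
u·Marg u`), `a(1 − L⁻²) < a_k` (B1 (2.15)) and the Dirichlet part of `form_Marg`. [cite: Balaban1983RegularityDecay, (1.8) p.573] -/
theorem Marg_coercive_dirE {a msq : ℝ} (ha : 0 < a) (hm : 0 ≤ msq) (hk1 : 1 ≤ k) (u : Site P 0 → ℝ) :
    min 1 (a * (1 - ((P.L : ℝ) ^ 2)⁻¹)) / 2 * (dirE P k u + nsq P u) ≤ u ⬝ᵥ (Marg P a msq k *ᵥ u) := by
  have hL1 := one_lt_cast_L P
  have hco := Marg_coercive (P := P) (a := a) hm k u
  have hak : a * (1 - ((P.L : ℝ) ^ 2)⁻¹) < B1.aSeq a P.L k := B1.ainf_lt_aSeq ha hL1 k hk1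
  have hak0 : 0 ≤ B1.aSeq a P.L k := (B1.aSeq_pos ha hL1 hk1).le
  have hform := form_Marg (P := P) a msq k u
  have hdir : dirE P k u ≤ u ⬝ᵥ (Marg P a msq k *ᵥ u) := by
    rw [hform, dirE_eq]
    have h1 : 0 ≤ P.spacing k ^ 2 * msq * (u ⬝ᵥ u) := mul_nonneg (by positivity) (dot_self_nonneg _)
    have h2 : 0 ≤ B1.aSeq a P.L k * (u ⬝ᵥ ((Qks P k * Qk P k) *ᵥ u)) :=
      mul_nonneg hak0 (dot_QksQk_self_nonneg k u)
    linarith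
  have hmin : min 1 (a * (1 - ((P.L : ℝ) ^ 2)⁻¹)) ≤ min 8 (B1.aSeq a P.L k) := by
    refine le_min ?_ ?_
    · exact (min_le_left _ _).trans (by norm_num)
    · exact (min_le_right _ _).trans hak.le
  have hnsq : min 1 (a * (1 - ((P.L : ℝ) ^ 2)⁻¹)) * nsq P u ≤ u ⬝ᵥ (Marg P a msq k *ᵥ u) := by
    rw [nsq_eq_dot]
    exact (mul_le_mul_of_nonneg_right hmin (dot_self_nonneg _)).trans hco
  have hm1 : min 1 (a * (1 - ((P.L : ℝ) ^ 2)⁻¹)) ≤ 1 := min_le_left _ _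
  have hd0 := dirE_nonneg (P := P) k u
  nlinarith

/-- the coercivity constant is positive: `0 < min{1, a(1 − L⁻²)}` for `a > 0`, `L > 1`. [cite: Balaban1982Higgs1, (2.15) p.609] -/
theorem gammaPrime_pos {a : ℝ} (ha : 0 < a) : 0 < min 1 (a * (1 - ((P.L : ℝ) ^ 2)⁻¹)) := by
  have hL1 := one_lt_cast_L P
  have hL2 : (1 : ℝ) < (P.L : ℝ) ^ 2 := by nlinarith
  have hinv : ((P.L : ℝ) ^ 2)⁻¹ < 1 := inv_lt_one_of_one_lt₀ hL2
  exact lt_min one_pos (mul_pos ha (by linarith))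

end Coercive

/-! ## §4 The weighted solves -/

section Solve

variable {ρ : Site P 0 → ℝ} {a msq δ : ℝ}

/-- **THE WEIGHTED SOLVE** (value source): for `ρ` Lipschitz, `1 ≤ k ≤ m + K`, `a > 0`, `m² ≥ 0`, `0 ≤ δ`, `4δ ≤ 1`,
`(2d + 4a)δ² ≤ ¼min{1, a(1 − L⁻²)}` and every source `g`, with `v = G_k^{resc}g`, `u = e^{δρ}v`:
`Σ_μ‖∂^η_μu‖² + ‖u‖² ≤ (4/min{1, a(1 − L⁻²)})²·‖e^{δρ}g‖²` (unweighted sums) — the `L²` bound (2.28) `0 < G_k(□,0) ≤ c₀I` and (2.29)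
surviving the conjugation `e^{δρ}·e^{−δρ}`. [cite: Balaban1983RegularityDecay, (2.28)–(2.29) p.580, (1.8) p.573] -/
theorem solve_bound (hρ : LipX P k ρ) (hk : k ≤ P.m + P.K) (hk1 : 1 ≤ k) (ha : 0 < a) (hm : 0 ≤ msq)
    (hδ0 : 0 ≤ δ) (hδ4 : 4 * δ ≤ 1) (hδγ : (2 * P.d + 4 * a) * δ ^ 2 ≤ min 1 (a * (1 - ((P.L : ℝ) ^ 2)⁻¹)) / 4)
    (g : Site P 0 → ℝ) :
    dirE P k (pmul (wt P δ ρ) (Grs P a msq k *ᵥ g)) + nsq P (pmul (wt P δ ρ) (Grs P a msq k *ᵥ g))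
      ≤ (4 / min 1 (a * (1 - ((P.L : ℝ) ^ 2)⁻¹))) ^ 2 * nsq P (pmul (wt P δ ρ) g) := by
  set γ' := min 1 (a * (1 - ((P.L : ℝ) ^ 2)⁻¹)) with hγ'
  have hγ : 0 < γ' := gammaPrime_pos ha
  set w := wt P δ ρ with hw
  set v := Grs P a msq k *ᵥ g with hv
  set u := pmul w v with hu
  have hMv : Marg P a msq k *ᵥ v = g := by
    rw [hv, Matrix.mulVec_mulVec, Marg_mul_Grs ha hm hk1, Matrix.one_mulVec]
  have hform : pmul w u ⬝ᵥ (Marg P a msq k *ᵥ pmul (fun z => (w z)⁻¹) u) = u ⬝ᵥ pmul w g := by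
    rw [hu, pmul_inv_pmul w v (wt_ne_zero δ ρ), hMv, pmul_pmul_dot]
  have hconj := conjMarg_ge hρ hk hk1 ha hδ0 (by linarith) msq u
  have hcoe := Marg_coercive_dirE (P := P) (k := k) ha hm hk1 u
  rw [← hγ'] at hcoe
  have hak : B1.aSeq a P.L k ≤ a := B1.aSeq_le ha (one_lt_cast_L P) k hk1
  have hX2 : 0 ≤ dirE P k u + nsq P u := add_nonneg (dirE_nonneg k u) (nsq_nonneg u)
  set X := Real.sqrt (dirE P k u + nsq P u) with hX
  set W := Real.sqrt (nsq P (pmul w g)) with hW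
  have hXsq : X ^ 2 = dirE P k u + nsq P u := Real.sq_sqrt hX2
  have hWsq : W ^ 2 = nsq P (pmul w g) := Real.sq_sqrt (nsq_nonneg _)
  have hcs : u ⬝ᵥ pmul w g ≤ Real.sqrt (nsq P u) * W := dot_le_sqrt_nsq u (pmul w g)
  have hnu : Real.sqrt (nsq P u) ≤ X := Real.sqrt_le_sqrt (by linarith [dirE_nonneg k u])
  have hW0 : 0 ≤ W := Real.sqrt_nonneg _
  have hmain : γ' / 2 / 2 * X ^ 2 ≤ X * W := by
    rw [hXsq]
    have hn0 := nsq_nonneg (P := P) u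
    have hδn : (2 * P.d + 4 * B1.aSeq a P.L k) * δ ^ 2 * nsq P u ≤ γ' / 4 * nsq P u := by
      refine mul_le_mul_of_nonneg_right ?_ hn0
      refine le_trans ?_ hδγ
      have hδ2 : 0 ≤ δ ^ 2 := sq_nonneg _
      nlinarith
    calc γ' / 2 / 2 * (dirE P k u + nsq P u)
        ≤ u ⬝ᵥ (Marg P a msq k *ᵥ u) - (2 * P.d + 4 * B1.aSeq a P.L k) * δ ^ 2 * nsq P u := by
          nlinarith [dirE_nonneg k u]
      _ ≤ u ⬝ᵥ pmul w g := by rw [← hform]; exact hconj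
      _ ≤ Real.sqrt (nsq P u) * W := hcs
      _ ≤ X * W := mul_le_mul_of_nonneg_right hnu hW0
  have hq := sq_le_of_quad (show 0 < γ' / 2 by positivity) (Real.sqrt_nonneg _) hW0 hmain
  rw [hXsq, hWsq] at hq
  calc _ ≤ (2 / (γ' / 2)) ^ 2 * nsq P (pmul w g) := hq
    _ = (4 / γ') ^ 2 * nsq P (pmul w g) := by
        congr 1
        rw [div_div_eq_mul_div]
        norm_num

/-- **THE WEIGHTED SOLVE WITH A DIVERGENCE SOURCE**: same data, `v = G_k^{resc}∂^{η⊤}_νg` (`∂^{η⊤}` = the transpose = the adjoint for the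
common weight `η^d`), `u = e^{δρ}v`:  `Σ_μ‖∂^η_μu‖² + ‖u‖² ≤ (8/min{1, a(1 − L⁻²)})²·‖e^{δρ}g‖²` — (2.29) *"‖G_k^{1/2}(□,0)∂^{η*}_μ‖_{2,2}
≤ 1"* surviving the conjugation (the derivative is moved onto `e^{δρ}u` by the weighted Leibniz rule `abs_deriv_pmul_le`, never through
`‖∂^⊤g‖ ∼ η⁻¹‖g‖`). [cite: Balaban1983RegularityDecay, (2.29) p.580, (1.8) p.573] -/
theorem solveT_bound (hρ : LipX P k ρ) (hk : k ≤ P.m + P.K) (hk1 : 1 ≤ k) (ha : 0 < a) (hm : 0 ≤ msq)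
    (hδ0 : 0 ≤ δ) (hδ4 : 4 * δ ≤ 1) (hδγ : (2 * P.d + 4 * a) * δ ^ 2 ≤ min 1 (a * (1 - ((P.L : ℝ) ^ 2)⁻¹)) / 4)
    (ν : Fin P.d) (g : Site P 0 → ℝ) :
    dirE P k (pmul (wt P δ ρ) (Grs P a msq k *ᵥ ((deriv P 0 ((P.L : ℝ) ^ k)⁻¹ ν)ᵀ *ᵥ g)))
        + nsq P (pmul (wt P δ ρ) (Grs P a msq k *ᵥ ((deriv P 0 ((P.L : ℝ) ^ k)⁻¹ ν)ᵀ *ᵥ g)))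
      ≤ (8 / min 1 (a * (1 - ((P.L : ℝ) ^ 2)⁻¹))) ^ 2 * nsq P (pmul (wt P δ ρ) g) := by
  set γ' := min 1 (a * (1 - ((P.L : ℝ) ^ 2)⁻¹)) with hγ'
  have hγ : 0 < γ' := gammaPrime_pos ha
  set w := wt P δ ρ with hw
  set D := deriv P 0 ((P.L : ℝ) ^ k)⁻¹ ν with hD
  set v := Grs P a msq k *ᵥ (Dᵀ *ᵥ g) with hv
  set u := pmul w v with hu
  have hMv : Marg P a msq k *ᵥ v = Dᵀ *ᵥ g := by
    rw [hv, Matrix.mulVec_mulVec, Marg_mul_Grs ha hm hk1, Matrix.one_mulVec]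
  have hform : pmul w u ⬝ᵥ (Marg P a msq k *ᵥ pmul (fun z => (w z)⁻¹) u) = (D *ᵥ pmul w u) ⬝ᵥ g := by
    rw [hu, pmul_inv_pmul w v (wt_ne_zero δ ρ), hMv, Matrix.dotProduct_mulVec, Matrix.vecMul_transpose]
  have hconj := conjMarg_ge hρ hk hk1 ha hδ0 (by linarith) msq u
  have hcoe := Marg_coercive_dirE (P := P) (k := k) ha hm hk1 u
  rw [← hγ'] at hcoe
  have hak : B1.aSeq a P.L k ≤ a := B1.aSeq_le ha (one_lt_cast_L P) k hk1
  have hX2 : 0 ≤ dirE P k u + nsq P u := add_nonneg (dirE_nonneg k u) (nsq_nonneg u)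
  set X := Real.sqrt (dirE P k u + nsq P u) with hX
  set W := Real.sqrt (nsq P (pmul w g)) with hW
  have hXsq : X ^ 2 = dirE P k u + nsq P u := Real.sq_sqrt hX2
  have hWsq : W ^ 2 = nsq P (pmul w g) := Real.sq_sqrt (nsq_nonneg _)
  have hW0 : 0 ≤ W := Real.sqrt_nonneg _
  have hX0 : 0 ≤ X := Real.sqrt_nonneg _
  have hsrc : (D *ᵥ pmul w u) ⬝ᵥ g ≤ 2 * (X * W) := by
    have hpt : ∀ x, (D *ᵥ pmul w u) x * g x
        ≤ 3 / 2 * (|(D *ᵥ u) x| * |pmul w g x|) + 1 / 2 * (|u x| * |pmul w g x|) := by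
      intro x
      have hb := abs_deriv_pmul_le hρ hδ0 hδ4 ν u x
      rw [← hD] at hb
      have h1 : (D *ᵥ pmul w u) x * g x ≤ |(D *ᵥ pmul w u) x| * |g x| := by
        rw [← abs_mul]; exact le_abs_self _
      have hwg : |pmul w g x| = w x * |g x| := by
        rw [pmul_apply, abs_mul, abs_of_pos (wt_pos δ ρ x)]
      rw [hwg]
      have hg0 := abs_nonneg (g x)
      have hw0 := (wt_pos (P := P) δ ρ x).le
      have h2δ : 2 * δ ≤ 1 / 2 := by linarith
      have h2 := mul_le_mul_of_nonneg_right hb hg0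
      have h3 : 2 * δ * |u x| ≤ 1 / 2 * |u x| := mul_le_mul_of_nonneg_right h2δ (abs_nonneg _)
      nlinarith [abs_nonneg ((D *ᵥ u) x), abs_nonneg (u x), mul_nonneg hw0 hg0]
    have hs1 := sum_abs_mul_abs_le_sqrt_nsq (D *ᵥ u) (pmul w g)
    have hs2 := sum_abs_mul_abs_le_sqrt_nsq u (pmul w g)
    obtain ⟨hp1, hp2⟩ := sqrt_parts_le k ν u
    rw [← hD] at hp2
    calc (D *ᵥ pmul w u) ⬝ᵥ g = ∑ x, (D *ᵥ pmul w u) x * g x := rfl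
      _ ≤ ∑ x, (3 / 2 * (|(D *ᵥ u) x| * |pmul w g x|) + 1 / 2 * (|u x| * |pmul w g x|)) := sum_le_sum fun x _ => hpt x
      _ = 3 / 2 * ∑ x, |(D *ᵥ u) x| * |pmul w g x| + 1 / 2 * ∑ x, |u x| * |pmul w g x| := by
          rw [sum_add_distrib, mul_sum, mul_sum]
      _ ≤ 3 / 2 * (X * W) + 1 / 2 * (X * W) := by
          have e1 := hs1.trans (mul_le_mul_of_nonneg_right hp2 hW0)
          have e2 := hs2.trans (mul_le_mul_of_nonneg_right hp1 hW0)
          linarith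
      _ = 2 * (X * W) := by ring
  have hmain : γ' / 2 / 2 * X ^ 2 ≤ X * (2 * W) := by
    rw [hXsq]
    have hn0 := nsq_nonneg (P := P) u
    have hδn : (2 * P.d + 4 * B1.aSeq a P.L k) * δ ^ 2 * nsq P u ≤ γ' / 4 * nsq P u := by
      refine mul_le_mul_of_nonneg_right ?_ hn0
      refine le_trans ?_ hδγ
      have hδ2 : 0 ≤ δ ^ 2 := sq_nonneg _
      nlinarith
    calc γ' / 2 / 2 * (dirE P k u + nsq P u)
        ≤ u ⬝ᵥ (Marg P a msq k *ᵥ u) - (2 * P.d + 4 * B1.aSeq a P.L k) * δ ^ 2 * nsq P u := by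
          nlinarith [dirE_nonneg k u]
      _ ≤ (D *ᵥ pmul w u) ⬝ᵥ g := by rw [← hform]; exact hconj
      _ ≤ X * (2 * W) := by linarith
  have hq := sq_le_of_quad (show 0 < γ' / 2 by positivity) hX0 (by positivity) hmain
  rw [hXsq] at hq
  calc _ ≤ (2 / (γ' / 2)) ^ 2 * (2 * W) ^ 2 := hq
    _ = (8 / γ') ^ 2 * W ^ 2 := by
        rw [div_div_eq_mul_div]
        ring
    _ = (8 / γ') ^ 2 * nsq P (pmul w g) := by rw [hWsq]

end Solve

end B4Cor23ZeroTorusSolve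

end

end Literature.MathematicalPhysics.QuantumFieldTheory.Balaban1983to89
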